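import Summits.Parity.GeneralizedHardyLittlewood.Theorems.GreenTaoLevelTwoMNTwoDepolarize

/-!
# Route `GreenTaoLevelTwo`, crux `MNTwo` (stmt-Parity-21276), line `birth`, stub `stub_mnVertical`:
# Lemma 27 for all pairs `h, h'` (symmetry and the degenerate case) (GT 2008b §11)

Block V5 of the `stub_mnVertical` census (B. Green, T. Tao, *Quadratic uniformity of the Möbius
function*, Ann. Inst. Fourier 58 (2008) = arXiv:math/0606087, §11 Lemma 27: "By symmetry we may
assume `‖h'‖_g ≤ ‖h‖_g`").  `…MNTwoDepolarize.depolarize` proves Lemma 27 under `0 < ν h' ≤ ν h`;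
this def-free wrapper removes both restrictions for a DEFINITE gauge (`ν x = 0 → x = 0`, true for
the rotation Bohr gauge `⨆ᵢ‖nαᵢ‖ + |n|/N`), using the symmetry `φ''(h,h') = φ''(h',h)` and
`φ''(h,0) = 0`.

* `depolarize_symm` — Lemma 27 for all `h, h'` with `ν h, ν h' < ρ₂`.

References: [GreenTao2008QuadraticMobius] arXiv:math/0606087 §11, Lemma 27.
-/

noncomputable section

open Finset Real

namespace Summit.Parity.GeneralizedHardyLittlewood.GreenTaoLevelTwoMNTwoDepolarizeSymm

open Summit.Parity.GeneralizedHardyLittlewood.GreenTaoLevelTwoMNTwoDepolarize (depolarize)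
open Summit.Parity.GeneralizedHardyLittlewood.GreenTaoLevelTwoMNTwoLocalQuadratic (second_deriv_comm)

/-- **Lemma 27 (GT 2008b §11) for all pairs.**  Hypotheses as in `…MNTwoDepolarize.depolarize`,
plus definiteness of the gauge; for all `h, h'` with `ν h, ν h' < ρ₂` there is
`1 ≤ q ≤ 25672 Q₁⁶` with `‖q•φ''(h,h')‖ ≤ 426133840896 Q₁¹³ K ν(h) ν(h')`.
[cite: GreenTao2008QuadraticMobius, Lemma 27] -/
theorem depolarize_symm (ν : ℤ → ℝ) (hν0 : ν 0 = 0) (hνnn : ∀ x, 0 ≤ ν x)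
    (hνneg : ∀ x, ν (-x) = ν x) (hνadd : ∀ x y, ν (x + y) ≤ ν x + ν y)
    (hνdef : ∀ x, ν x = 0 → x = 0) (φ : ℤ → UnitAddCircle) {n₀ : ℤ} {R : ℝ}
    (hφ : ∀ n a b c : ℤ, ν (n - n₀) < R → ν (n + a - n₀) < R → ν (n + b - n₀) < R →
      ν (n + c - n₀) < R → ν (n + a + b - n₀) < R → ν (n + a + c - n₀) < R →
      ν (n + b + c - n₀) < R → ν (n + a + b + c - n₀) < R →
      φ (n + a + b + c) - φ (n + a + b) - φ (n + a + c) - φ (n + b + c)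
        + φ (n + a) + φ (n + b) + φ (n + c) - φ n = 0)
    {ρ₀ ρ₂ Q₁ K : ℝ} (hK : 0 ≤ K) (hQ₁ : 1 ≤ Q₁)
    (h26 : ∀ a : ℤ, ν a < ρ₀ → ∃ q : ℕ, 1 ≤ q ∧ (q : ℝ) ≤ Q₁ ∧
      ‖((q : ℤ)) • (φ (n₀ + a + a) - φ (n₀ + a) - φ (n₀ + a) + φ n₀)‖ ≤ K * ν a ^ 2)
    (hρ : 9 * ρ₂ ≤ ρ₀) (hR : 18 * ρ₂ ≤ R) (hsmall : 648 * Q₁ ^ 3 * K * ρ₂ ^ 2 ≤ 1)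
    {h h' : ℤ} (hh : ν h < ρ₂) (hh' : ν h' < ρ₂) :
    ∃ q : ℕ, 1 ≤ q ∧ (q : ℝ) ≤ 25672 * Q₁ ^ 6 ∧
      ‖((q : ℤ)) • (φ (n₀ + h + h') - φ (n₀ + h) - φ (n₀ + h') + φ n₀)‖ ≤
        426133840896 * Q₁ ^ 13 * K * ν h * ν h' := by
  have hQ6 : (1 : ℝ) ≤ 25672 * Q₁ ^ 6 := by
    have : (1 : ℝ) ≤ Q₁ ^ 6 := one_le_pow₀ hQ₁; linarith
  -- degenerate cases `ν h' = 0` or `ν h = 0`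
  by_cases hz' : ν h' = 0
  · have : h' = 0 := hνdef h' hz'
    subst this
    refine ⟨1, le_rfl, by simpa using hQ6, ?_⟩
    rw [hz', add_zero]; simp
  by_cases hz : ν h = 0
  · have : h = 0 := hνdef h hz
    subst this
    refine ⟨1, le_rfl, by simpa using hQ6, ?_⟩
    rw [hz, add_zero]; simp
  have hpos' : 0 < ν h' := lt_of_le_of_ne (hνnn h') (Ne.symm hz')
  have hpos : 0 < ν h := lt_of_le_of_ne (hνnn h) (Ne.symm hz)
  rcases le_total (ν h') (ν h) with hle | hle
  · exact depolarize ν hν0 hνnn hνneg hνadd φ hφ hK hQ₁ h26 hρ hR hsmall hh hle hpos'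
  · obtain ⟨q, hq1, hqQ, hb⟩ :=
      depolarize ν hν0 hνnn hνneg hνadd φ hφ hK hQ₁ h26 hρ hR hsmall hh' hle hpos
    refine ⟨q, hq1, hqQ, ?_⟩
    rw [second_deriv_comm φ n₀ h h']
    calc _ ≤ 426133840896 * Q₁ ^ 13 * K * ν h' * ν h := hb
      _ = 426133840896 * Q₁ ^ 13 * K * ν h * ν h' := by ring

end Summit.Parity.GeneralizedHardyLittlewood.GreenTaoLevelTwoMNTwoDepolarizeSymm
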